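/-
Copyright (c) 2026 the pub-hodgecm-mathlib formalisation cell (harness21).  Prover seat hodgecm-mathlib-LH4-p04 (g3), req620 Track A «(D-RAM) FOUR-FRAME» squad
(unit U3_Laws under (R-22) «κS-RECUT», THE (κS-B₀²) PAYER: `KSB02-PAYER-PLAN.v1.LH4p04g3.md` b501bd1f2cece99b file (D) HEAD; dealer∕pen LH4-plan (g12) WORDS #12∕#14,
heir LEAD F0P3a-plan (g19) T18-53 ORDER OF SHAPE ∕ T18-57, REF5 (g22) R5-115∕R5-135, LH4-r01 (g4) GZ; trunk LH4-p05 (g4) ★ p857082, H corner LH4-p06 (g4) ★ p857084).  2026-09-04.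
-/
import Summits.HodgeConjecture.HodgeConjecture.Theorems.F0P3cDyRamKappaCountTypeZeroSigned          -- ★ p857082 (A) TRUNK (LH4-p05 (g4)): `finsum_kappaCount_typeZero_eq_token_mul_ampl` — the signed (κ-B₀) road at the witness token; brings ★ `exists_glue_witness`, ★ §P, ★ `shiftR`
import Summits.HodgeConjecture.HodgeConjecture.Theorems.F0P3cDyRamDiagonalGlueSignTokenRotations   -- (C1) (this seat): the witness tokens = the law token, slot by slot, four shapes; brings ★ p857084 (C0), ★ p856992 (`ampl_eq_zero_of_nonpos`), ★ p857033 `omegaR`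
import HarnessLib

/-!
# Crux `H413`, line LH4 «(D-RAM) FOUR-FRAME» road — unit U3_Laws (iii), (R-22) «κS-RECUT»: THE (κS-B₀²) CHILD PAID —
# `Σᶠ_{M ∈ 𝓛₀(T), dualisable} κ₀,ᵢ(M)·w(M) = Ω_i·w_i·baseSign_i·ω(fPartProd δ (a,b,1) i) · ampl(q, k, B)∕4` at the schedule of record `Ω = omegaR`, unconditionally

Cell `hodgecm-mathlib` (D-0151), FLOOR 0, crux item H413 = `stmt-HodgeConjecture-24833`, route of record `HCCMUnconditional`; squad F0∕P3c∕LH4 (req618∕req620); registered stub served: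
`F0P3cDyRamFourFrameU3.stub_U3_kappaSignCount2_typeZero` ((κS-B₀²), tree `Cruxes/H413/Lines/F0_P3c_DyRamFourFrame_U3_Laws.lean` ED. 13 e4c3fb8d387887e8 :592 — the `hBκS20` binder of
★ p856996 `kappaSignModelSum2_of_kappaStageB_complete omegaR`).  THEOREMS ONLY (no `def`, no instance, no notation, no `sorry`, default heartbeats); lane `--supports
stmt-HodgeConjecture-24833 --as helper` (count-neutral).  ONE theorem, whose TYPE is the (κS-B₀²) sentence TOKEN FOR TOKEN (`[CompleteSpace K]`, `depthOfRecord d`, `shiftR d t`,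
`omegaR K σ ϖ d a b i`, `baseSign`, `fPartProd δ ![a, b, 1] i`, `ampl`).

THE PROOF («TRUNK ⊕ DICTIONARY», plan v1 §1).  (1) Pick the three σ-fixed glue witnesses `f₀ f₁ f₂` of the square element datum `(a², b²)`, of its swap and of its rescaling (★
`exists_glue_witness`, precision `n_apex − d + 1`).  (2) ★ TRUNK p857082 (the ★ (κ-B₀) road p856859 minus its `|·|` line, over ★ κ-BOX-SUM p856906 and the seven ★ type-0 κ-sockets):
`Σᶠ = WTOK · ampl q k B ∕ 4`, `WTOK` = the H letters `(ω(−(1+f₀)), ω(f₀)ω(−(1+f₀)), ω(f₀))_i` on the equilateral key, else the G letters `εG p i` of the apex foot `p`.  (3) DEAD axis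
(`B ≤ 0`): `ampl = 0` on both sides (★ `ampl_eq_zero_of_nonpos`) — the junk value of `Ω` is never read (REF5 R5-115 (2)).  (4) ALIVE axis (`B ≥ 1`, i.e. `n_i ≥ 3d − 2(d%2) ≥ 3d − 2`
since `shiftR d t = d − d%2`): the witness precision meets the dictionary's threshold (`2d − 1` absolute at an apex, `2d − 1` relative at a cross slot — plan §1 step 3, REF5 R5-135 «=»),
so (C1) `footZero∕footOne∕footTwo_slot_*` ∕ `hCorner_slot` rewrite `WTOK` into the law token `omegaR_i · (ω(−1), ω(−1), 1)_i · baseSign_i · ω(fPP_i)` — Ω entering exactly through the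
representatives `u₂ = f₀x₀₂∕x₂₁ ~ b∕a`, `u₀ = (1+f₀)x₀₂∕x₀₁ ~ b`, `u₀∕u₂ ~ a` the witness itself supplies (★ p857084 (C0), LH4-p06 (g4)).  Uniform in `(d, t)`: the payer never proves
`Ω = 1`; on the covered set `d % 2 = 1 ∨ 2d ≤ t + 2` the consumers recover the struck (κS-B₀) through ★ p857007 ∕ ★ p857042 (LH4-p10 (g3)).  The root guards `|a − 1|, |b − 1| < |2|` are
idle here (the RHS is root-choice invariant).
HONEST LABEL.  Count-neutral (`--supports`); this settles the re-lettered SIGNED type-0 κ-census child of U3 (an empirical census law in diagonal-model currency, now a theorem); (κS-B₂²)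
and the (ρ2b′-X) row remain PROVER TARGETS; nothing printed is asserted; `HC_CM` is proved only modulo the 7 printed citations (2 remaining named inputs: hLiu418 =
`stmt-HodgeConjecture-24832`, h413 = `stmt-HodgeConjecture-24833`) until rung 0 closes.

## References
* [Kottwitz1986BaseChangeUnits] R. E. Kottwitz, *Base change for unit elements of Hecke algebras*, Compositio Math. 60 (1986), §1 pp. 240–241 (κ-orbital integrals of units as
  signed lattice counts modulo the torus).
* [Rogawski1990] J. D. Rogawski, *Automorphic Representations of Unitary Groups in Three Variables*, Ann. of Math. Stud. 123 (1990), §4.9 Prop. 4.9.1 (a) p. 55, §4.10 p. 58.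
* [LanglandsShelstad1987] R. P. Langlands, D. Shelstad, *On the definition of transfer factors*, Math. Ann. 278 (1987), §3 (κ as a character of `H¹(F, T)`).
* [Serre1979] J.-P. Serre, *Local Fields*, GTM 67 (1979), Ch. V §3 Prop. 5, Cor. 3.
-/

set_option autoImplicit false

noncomputable section

namespace Summit.HodgeConjecture.HodgeConjecture.Cruxes.H413.F0P3cDyRamKappaSignCount2TypeZero

open Literature.NumberTheory.Automorphic Literature.NumberTheory.Automorphic.HermitianLattice
open Literature.NumberTheory.Automorphic.UnitaryLatticeTree Literature.NumberTheory.Automorphic.UnitaryThreeFourFrame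
open Literature.NumberTheory.LocalFields Literature.NumberTheory.LocalFields.WildQuadraticDatum
open Summit.HodgeConjecture.HodgeConjecture.Cruxes.H413.F0P3cDyRamFourFrameLawDefsR (shiftR)
open Summit.HodgeConjecture.HodgeConjecture.Cruxes.H413.F0P3cDyRamDiagonalTorusDefs (normalisedStableLattices stabiliserWeight IsDualisableLattice)
open Summit.HodgeConjecture.HodgeConjecture.Cruxes.H413.F0P3cDyRamDiagonalKappaCountDefs (kappaCount)
open Summit.HodgeConjecture.HodgeConjecture.Cruxes.H413.F0P3cDyRamOmegaRDefs (omegaR)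
open Summit.HodgeConjecture.HodgeConjecture.Cruxes.H413.F0P3cDyRamKappaAssemblyTools (exists_glue_witness)
open Summit.HodgeConjecture.HodgeConjecture.Cruxes.H413.F0P3cDyRamDiagonalPermutation (isElementDatum_swap isElementDatum_rescale)
open Summit.HodgeConjecture.HodgeConjecture.Cruxes.H413.F0P3cDyRamElementDatumParity (isoceles_of_isElementDatum)
open Summit.HodgeConjecture.HodgeConjecture.Cruxes.H413.F0P3cDyRamKappaCountTypeZeroSigned (finsum_kappaCount_typeZero_eq_token_mul_ampl)
open Summit.HodgeConjecture.HodgeConjecture.Cruxes.H413.F0P3cDyRamDiagonalGlueSignDefs (IsGlueRep glueSign)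
open Summit.HodgeConjecture.HodgeConjecture.Cruxes.H413.F0P3cDyRamDiagonalGlueSignEval (ampl_eq_zero_of_nonpos)
open Summit.HodgeConjecture.HodgeConjecture.Cruxes.H413.F0P3cDyRamDiagonalKappaCoreHangingOmega (isGlueRep_div_of_glueWitness isGlueRep_of_glueWitness isGlueRep_root_of_glueWitness)
open Summit.HodgeConjecture.HodgeConjecture.Cruxes.H413.F0P3cDyRamDiagonalGlueSignTokenRotations
open scoped Valued WithZero Matrix MatrixGroups

/-! ## §0  «JUNK NEVER READ» — an axis of depth `≥ 3d − 2`, in particular an alive one, carries a glue representative (heir LEAD T18-59 (b)(iv); REF5 R5-115 (2)) -/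

/-- **DEPTH `nᵢ ≥ 3d − 2` ⟹ THE UNIT OF AXIS `i` HAS A GLUE REPRESENTATIVE** (REF5 R5-115 (2) «a representative mod `U_E^{(2d−1)}` exists ⟺ `nᵢ ≥ 3d − 2`», the `⟸` half,
made constructive).  At a wild ramified quadratic datum, for every square element datum `(a², b²; n₁, n₂, n₃)` at the depth of record and every slot `i` with `3d − 2 ≤ nᵢ`, the unit
`(b, a, b∕a)_i` has a σ-fixed unit representative modulo `U_E^{(2d−1)}`: the ★ glue witness of the apex foot through axis `i` (of the datum, its swap `(b, a)` or its rescaling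
`(a⁻¹, b·a⁻¹)`; precision `n_apex − d + 1` absolute, `m − d + 1` relative) meets the level `2d − 1`, so ★ p857084's representatives-from-the-witness apply (skew element `ϖ − σϖ`;
`isGlueRep_inv` ∕ `inv_div` ∕ `b·a⁻¹∕a⁻¹ = b` for the transports).  Type-blind: the (κS-B₂²) payer keys its alive axis (`ampl q k (B + τ d) ≠ 0 ⟺ nᵢ ≥ 3d − 2 + 2(d % 2)`) on the same
lemma (LH4-p07 (g6) ∕ LH4-p10 (g3) factoring ask).  No `(d, t)` case split, no covered-set guard, no `Ω = 1`.
[cite: Serre1979, Ch. V §3 Prop. 5, Cor. 3] [cite: Rogawski1990, §4.9 Prop. 4.9.1 (a) p. 55, §4.10 p. 58] -/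
theorem exists_isGlueRep_of_le_depth
    {K : Type} [Field K] [Valued K ℤᵐ⁰] [CompleteSpace K] [Fintype 𝓀[K]] {σ : K →+* K} {ϖ : K} {d t : ℕ} (hD : IsRamifiedQuadraticDatum σ ϖ d t)
    {a b : K} (ha : a * σ a = 1) (hb : b * σ b = 1) {n₁ n₂ n₃ : ℕ} (hE : IsElementDatum σ ϖ (depthOfRecord d) (a * a) (b * b) n₁ n₂ n₃)
    (i : Fin 3) (hn : 3 * d - 2 ≤ (![n₁, n₂, n₃] : Fin 3 → ℕ) i) :
    ∃ u : K, IsGlueRep σ ϖ d ((![b, a, b / a] : Fin 3 → K) i) u := by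
  obtain ⟨hσ, hvσ, hϖ, -, hdϖ, hd1, -⟩ := id hD
  have hϖ0 : ϖ ≠ 0 := fun h => by rw [h, map_zero] at hϖ; exact WithZero.coe_ne_zero hϖ.symm
  have hϖ1 : Valued.v ϖ < 1 := by rw [hϖ, ← WithZero.exp_zero, WithZero.exp_lt_exp]; omega
  have hv0 : ∀ n : ℕ, Valued.v ϖ ^ n ≠ 0 := fun n => pow_ne_zero _ ((Valuation.ne_zero_iff _).2 hϖ0)
  have hmono : ∀ {m n : ℕ}, m ≤ n → Valued.v ϖ ^ n ≤ Valued.v ϖ ^ m := fun h => pow_le_pow_right_of_le_one' hϖ1.le h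
  -- the skew element `δ₀ = ϖ − σϖ ≠ 0`
  have hδ : σ (ϖ - σ ϖ) = -(ϖ - σ ϖ) := by rw [map_sub, hσ]; ring
  have hδ0 : ϖ - σ ϖ ≠ 0 := fun h => hv0 d (by rw [← hdϖ, h, map_zero])
  have hN₀ : d ≤ depthOfRecord d := by unfold depthOfRecord; split_ifs <;> omega
  obtain ⟨-, -, -, -, -, h₁, h₂, h₃, hN₁, hN₂, hN₃⟩ := id hE
  have hd₁ : d ≤ n₁ := hN₀.trans hN₁
  have hd₂ : d ≤ n₂ := hN₀.trans hN₂
  have hd₃ : d ≤ n₃ := hN₀.trans hN₃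
  have ha0 : a ≠ 0 := fun h => by rw [h, zero_mul] at ha; exact zero_ne_one ha
  have hb0 : b ≠ 0 := fun h => by rw [h, zero_mul] at hb; exact zero_ne_one hb
  have hva : Valued.v a = 1 := UnitaryThreeFourFrame.v_eq_one_of_mul_map_eq_one hvσ ha
  have hvb : Valued.v b = 1 := UnitaryThreeFourFrame.v_eq_one_of_mul_map_eq_one hvσ hb
  have hα1 : a * a ≠ 1 := fun h => hv0 n₂ (by rw [← h₂, h, sub_self, map_zero])
  have hβ1 : b * b ≠ 1 := fun h => hv0 n₁ (by rw [← h₁, h, sub_self, map_zero])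
  have hαβ : a * a ≠ b * b := fun h => hv0 n₃ (by rw [← h₃, h, sub_self, map_zero])
  have hβα : b * b ≠ a * a := fun h => hαβ h.symm
  have h₃' : Valued.v (b * b - a * a) = Valued.v ϖ ^ n₃ := by rw [Valuation.map_sub_swap, h₃]
  -- the three witnesses
  obtain ⟨f₀, hσf₀, hf₀⟩ := exists_glue_witness hD hE hN₀
  obtain ⟨f₁, hσf₁, hf₁⟩ := exists_glue_witness hD (isElementDatum_swap hE) hN₀
  obtain ⟨f₂, hσf₂, hf₂⟩ := exists_glue_witness hD (isElementDatum_rescale hvσ hE) hN₀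
  -- the valuation letters of the three glue units
  obtain ⟨hg₀, h1g₀⟩ := v_glueUnit_letters hϖ0 h₁ h₂ h₃
  obtain ⟨hg₁, h1g₁⟩ := v_glueUnit_letters hϖ0 h₂ h₁ h₃'
  obtain ⟨ha', hb', k₁, k₂, k₃, hgsp⟩ := rescale_letters hvσ ha hb h₁ h₂ h₃
  obtain ⟨hg₂, h1g₂⟩ := v_glueUnit_letters hϖ0 k₁ k₂ k₃
  have hα1' : a⁻¹ * a⁻¹ ≠ 1 := fun h => hv0 n₂ (by rw [← k₂, h, sub_self, map_zero])
  have hβ1' : b * a⁻¹ * (b * a⁻¹) ≠ 1 := fun h => hv0 n₃ (by rw [← k₁, h, sub_self, map_zero])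
  have hαβ' : a⁻¹ * a⁻¹ ≠ b * a⁻¹ * (b * a⁻¹) := fun h => hv0 n₁ (by rw [← k₃, h, sub_self, map_zero])
  rcases isoceles_of_isElementDatum hD hE with ⟨h12, h13⟩ | ⟨h13, h12⟩ | ⟨h23, h21⟩
  · -- FOOT 2 (`n₁ = n₂ ≤ n₃`): the rescaled datum `(a⁻¹, b·a⁻¹)`, units `(b″∕a″, a″, b″) = (b, a⁻¹, b∕a)`
    have hw := hf₂ h12.symm (h12 ▸ h13)
    rw [← hgsp] at hw
    fin_cases i
    · simp only [Fin.zero_eta, Fin.isValue, Matrix.cons_val_zero] at hn ⊢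
      have hrel : Valued.v (f₂ + (b * a⁻¹ * (b * a⁻¹) - 1) / (a⁻¹ * a⁻¹ - 1)) ≤
          Valued.v ϖ ^ (n₂ - d + 1) * Valued.v ((b * a⁻¹ * (b * a⁻¹) - 1) / (a⁻¹ * a⁻¹ - 1)) := by
        rw [hg₂ (h12 ▸ h13), ← pow_add, show n₂ - d + 1 + (n₃ - n₂) = n₃ - d + 1 by omega]; exact hw
      have h := isGlueRep_div_of_glueWitness hD hδ hδ0 ha' hb' hα1' hβ1' hσf₂ (by omega) hrel
      rw [show b * a⁻¹ / a⁻¹ = b from by field_simp] at h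
      exact ⟨_, h⟩
    · simp only [Fin.mk_one, Fin.isValue, Matrix.cons_val_one, Matrix.cons_val_zero] at hn ⊢
      have hrel : Valued.v (f₂ + (b * a⁻¹ * (b * a⁻¹) - 1) / (a⁻¹ * a⁻¹ - 1)) ≤
          Valued.v ϖ ^ (n₂ - d + 1) * Valued.v ((b * a⁻¹ * (b * a⁻¹) - 1) / (a⁻¹ * a⁻¹ - 1)) := by
        rw [hg₂ (h12 ▸ h13), ← pow_add, show n₂ - d + 1 + (n₃ - n₂) = n₃ - d + 1 by omega]; exact hw
      have hrel' : Valued.v (f₂ + (b * a⁻¹ * (b * a⁻¹) - 1) / (a⁻¹ * a⁻¹ - 1)) ≤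
          Valued.v ϖ ^ (n₂ - d + 1) * Valued.v (1 - (b * a⁻¹ * (b * a⁻¹) - 1) / (a⁻¹ * a⁻¹ - 1)) := by
        rw [h1g₂ h12.symm.le, ← h12, Nat.sub_self, pow_zero, mul_one]; exact hw.trans (hmono (by omega))
      have h := isGlueRep_inv (by rw [map_inv₀, hva, inv_one]) (isGlueRep_root_of_glueWitness hD hδ hδ0 ha' hb' hα1' hβ1' hαβ' hσf₂ (by omega) hrel hrel')
      rw [inv_inv] at h
      exact ⟨_, h⟩
    · simp only [Fin.reduceFinMk, Matrix.cons_val_two, Matrix.tail_cons, Matrix.head_cons] at hn ⊢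
      have hrel' : Valued.v (f₂ + (b * a⁻¹ * (b * a⁻¹) - 1) / (a⁻¹ * a⁻¹ - 1)) ≤
          Valued.v ϖ ^ (n₃ - d + 1) * Valued.v (1 - (b * a⁻¹ * (b * a⁻¹) - 1) / (a⁻¹ * a⁻¹ - 1)) := by
        rw [h1g₂ h12.symm.le, ← h12, Nat.sub_self, pow_zero, mul_one]; exact hw
      have h := isGlueRep_of_glueWitness hD hδ hδ0 ha' hb' hα1' hαβ' hσf₂ (by omega) hrel'
      rw [← div_eq_mul_inv] at h
      exact ⟨_, h⟩
  · -- FOOT 1 (`n₁ = n₃ ≤ n₂`): the swapped datum `(b, a)`, units `(a′, b′, b′∕a′) = (b, a, a∕b)`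
    have hw := hf₁ h13 h12
    fin_cases i
    · simp only [Fin.zero_eta, Fin.isValue, Matrix.cons_val_zero] at hn ⊢
      have hrel : Valued.v (f₁ + (a * a - 1) / (b * b - 1)) ≤ Valued.v ϖ ^ (n₁ - d + 1) * Valued.v ((a * a - 1) / (b * b - 1)) := by
        rw [hg₁ h12, ← pow_add, show n₁ - d + 1 + (n₂ - n₁) = n₂ - d + 1 by omega]; exact hw
      have hrel' : Valued.v (f₁ + (a * a - 1) / (b * b - 1)) ≤ Valued.v ϖ ^ (n₁ - d + 1) * Valued.v (1 - (a * a - 1) / (b * b - 1)) := by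
        rw [h1g₁ h13.le, ← h13, Nat.sub_self, pow_zero, mul_one]; exact hw.trans (hmono (by omega))
      exact ⟨_, isGlueRep_root_of_glueWitness hD hδ hδ0 hb ha hβ1 hα1 hβα hσf₁ (by omega) hrel hrel'⟩
    · simp only [Fin.mk_one, Fin.isValue, Matrix.cons_val_one, Matrix.cons_val_zero] at hn ⊢
      have hrel' : Valued.v (f₁ + (a * a - 1) / (b * b - 1)) ≤ Valued.v ϖ ^ (n₂ - d + 1) * Valued.v (1 - (a * a - 1) / (b * b - 1)) := by
        rw [h1g₁ h13.le, ← h13, Nat.sub_self, pow_zero, mul_one]; exact hw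
      exact ⟨_, isGlueRep_of_glueWitness hD hδ hδ0 hb ha hβ1 hβα hσf₁ (by omega) hrel'⟩
    · simp only [Fin.reduceFinMk, Matrix.cons_val_two, Matrix.tail_cons, Matrix.head_cons] at hn ⊢
      have hrel : Valued.v (f₁ + (a * a - 1) / (b * b - 1)) ≤ Valued.v ϖ ^ (n₁ - d + 1) * Valued.v ((a * a - 1) / (b * b - 1)) := by
        rw [hg₁ h12, ← pow_add, show n₁ - d + 1 + (n₂ - n₁) = n₂ - d + 1 by omega]; exact hw
      have h := isGlueRep_inv (by rw [map_div₀, hva, hvb, div_one]) (isGlueRep_div_of_glueWitness hD hδ hδ0 hb ha hβ1 hα1 hσf₁ (by omega) hrel)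
      rw [inv_div] at h
      exact ⟨_, h⟩
  · -- FOOT 0 ∕ H CORNER (`n₂ = n₃ ≤ n₁`): the datum `(a, b)` itself, units `(b, a, b∕a)`
    have hw := hf₀ h23 h21
    fin_cases i
    · simp only [Fin.zero_eta, Fin.isValue, Matrix.cons_val_zero] at hn ⊢
      have hrel' : Valued.v (f₀ + (b * b - 1) / (a * a - 1)) ≤ Valued.v ϖ ^ (n₁ - d + 1) * Valued.v (1 - (b * b - 1) / (a * a - 1)) := by
        rw [h1g₀ h23.le, ← h23, Nat.sub_self, pow_zero, mul_one]; exact hw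
      exact ⟨_, isGlueRep_of_glueWitness hD hδ hδ0 ha hb hα1 hαβ hσf₀ (by omega) hrel'⟩
    · simp only [Fin.mk_one, Fin.isValue, Matrix.cons_val_one, Matrix.cons_val_zero] at hn ⊢
      have hrel : Valued.v (f₀ + (b * b - 1) / (a * a - 1)) ≤ Valued.v ϖ ^ (n₂ - d + 1) * Valued.v ((b * b - 1) / (a * a - 1)) := by
        rw [hg₀ h21, ← pow_add, show n₂ - d + 1 + (n₁ - n₂) = n₁ - d + 1 by omega]; exact hw
      have hrel' : Valued.v (f₀ + (b * b - 1) / (a * a - 1)) ≤ Valued.v ϖ ^ (n₂ - d + 1) * Valued.v (1 - (b * b - 1) / (a * a - 1)) := by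
        rw [h1g₀ h23.le, ← h23, Nat.sub_self, pow_zero, mul_one]; exact hw.trans (hmono (by omega))
      exact ⟨_, isGlueRep_root_of_glueWitness hD hδ hδ0 ha hb hα1 hβ1 hαβ hσf₀ (by omega) hrel hrel'⟩
    · simp only [Fin.reduceFinMk, Matrix.cons_val_two, Matrix.tail_cons, Matrix.head_cons] at hn ⊢
      have hrel : Valued.v (f₀ + (b * b - 1) / (a * a - 1)) ≤ Valued.v ϖ ^ (n₂ - d + 1) * Valued.v ((b * b - 1) / (a * a - 1)) := by
        rw [hg₀ h21, ← pow_add, show n₂ - d + 1 + (n₁ - n₂) = n₁ - d + 1 by omega]; exact hw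
      exact ⟨_, isGlueRep_div_of_glueWitness hD hδ hδ0 ha hb hα1 hβ1 hσf₀ (by omega) hrel⟩


/-- **ALIVE ⟹ A REPRESENTATIVE EXISTS — the junk branch `Ω := 1` of `glueSign` is never read (heir LEAD T18-59 (b)(iv); REF5 R5-115 (2)).**  For every slot `i` and
`2B = nᵢ − d + 2 − 2·shiftR d t`: if the type-0 amplitude `ampl q k B` is non-zero then `B ≥ 1`, so `nᵢ ≥ 3d − 2(d % 2) ≥ 3d − 2` (`shiftR d t = d − d % 2`), and
`exists_isGlueRep_of_le_depth` gives the representative of `(b, a, b∕a)_i` — `omegaR K σ ϖ d a b i` is an honest norm class on every read axis (★ `glueSign_eq_normSign`).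
[cite: Serre1979, Ch. V §3 Prop. 5, Cor. 3] [cite: Rogawski1990, §4.9 Prop. 4.9.1 (a) p. 55, §4.10 p. 58] -/
theorem exists_isGlueRep_of_ampl_ne_zero
    {K : Type} [Field K] [Valued K ℤᵐ⁰] [CompleteSpace K] [Fintype 𝓀[K]] {σ : K →+* K} {ϖ : K} {d t : ℕ} (hD : IsRamifiedQuadraticDatum σ ϖ d t)
    {a b : K} (ha : a * σ a = 1) (hb : b * σ b = 1) {n₁ n₂ n₃ : ℕ} (hE : IsElementDatum σ ϖ (depthOfRecord d) (a * a) (b * b) n₁ n₂ n₃)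
    (k : ℕ) (i : Fin 3) (B : ℤ) (hB : 2 * B = ((![n₁, n₂, n₃] : Fin 3 → ℕ) i : ℤ) - d + 2 - 2 * shiftR d t) (hampl : ampl (Fintype.card 𝓀[K]) k B ≠ 0) :
    ∃ u : K, IsGlueRep σ ϖ d ((![b, a, b / a] : Fin 3 → K) i) u := by
  have hB1 : 1 ≤ B := by
    by_contra h
    exact hampl (ampl_eq_zero_of_nonpos (Fintype.card_pos_iff.2 ⟨0⟩) k (by omega))
  have hshift : shiftR d t = ((d - d % 2 : ℕ) : ℤ) := rfl
  rw [hshift] at hB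
  exact exists_isGlueRep_of_le_depth hD ha hb hE i (by omega)

/-! ## §1  The (κS-B₀²) child, unconditionally -/

/-- **(κS-B₀²) «TYPE 0, SIGNED, Ω-AWARE» — THE κ-WEIGHTED TYPE-0 CENSUS LAW OF THE DIAGONAL MODEL WITH ITS SIGN.**  For every wild ramified quadratic datum on a complete field with
finite residue field (`|2| < 1`), skew `δ ≠ 0`, norm-one roots `a, b` under the root guard, every square element datum `(a², b²; n₁, n₂, n₃)` at the depth of record, `T = diag(a², b², 1)`,
`2k + d = n₁ + n₂ + n₃ + 2`, every slot `i` and `2B = nᵢ − d + 2 − 2·shiftR d t`: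
`Σᶠ_{M ∈ 𝓛₀(T), dualisable} κ₀,ᵢ(M)·w(M) = omegaR_i · (ω(−1), ω(−1), 1)_i · baseSign_i · ω(fPartProd δ (a,b,1) i) · ampl(q, k, B)∕4` — the sentence of `stub_U3_kappaSignCount2_typeZero`
(U3 ED. 13 :592) TOKEN FOR TOKEN: ★ TRUNK p857082 at the three ★ glue witnesses, then dead axis ⇒ `ampl = 0`, alive axis ⇒ the (C1) token table (the representative read there
exists by §0 `exists_isGlueRep_of_le_depth` ∕ `exists_isGlueRep_of_ampl_ne_zero` — the junk branch of `glueSign` is never read).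
[cite: Kottwitz1986BaseChangeUnits, §1 pp. 240–241] [cite: Rogawski1990, §4.9 Prop. 4.9.1 (a) p. 55; §4.10 p. 58] [cite: LanglandsShelstad1987, §3] [cite: Serre1979, Ch. V §3 Prop. 5, Cor. 3] -/
theorem kappaSignCount2_typeZero :
    ∀ {K : Type} [Field K] [Valued K ℤᵐ⁰] [CompleteSpace K] [Fintype 𝓀[K]] {σ : K →+* K} {ϖ : K} {d t : ℕ}, IsRamifiedQuadraticDatum σ ϖ d t →
      Valued.v (2 : K) < 1 → ∀ {δ : K}, σ δ = -δ → δ ≠ 0 →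
      ∀ {a b : K}, a * σ a = 1 → b * σ b = 1 → Valued.v (a - 1) < Valued.v (2 : K) → Valued.v (b - 1) < Valued.v (2 : K) →
      ∀ {n₁ n₂ n₃ : ℕ}, IsElementDatum σ ϖ (depthOfRecord d) (a * a) (b * b) n₁ n₂ n₃ →
      ∀ (T : GL (Fin 3) K), (T : Matrix (Fin 3) (Fin 3) K) = Matrix.diagonal ![a * a, b * b, 1] → ∀ (k : ℕ), 2 * k + d = n₁ + n₂ + n₃ + 2 →
      ∀ (i : Fin 3) (B : ℤ), 2 * B = ((![n₁, n₂, n₃] : Fin 3 → ℕ) i : ℤ) - d + 2 - 2 * shiftR d t →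
        ∑ᶠ M ∈ {M : Submodule 𝒪[K] (Fin 3 → K) | M ∈ normalisedStableLattices T ∧ IsDualisableLattice σ ϖ M},
            (kappaCount σ ϖ 0 i M : ℚ) * stabiliserWeight σ M =
          ((omegaR K σ ϖ d a b i * ((![normSign σ (-1 : K), normSign σ (-1 : K), 1] : Fin 3 → ℤ) i *
            (baseSign σ i * normSign σ (fPartProd δ ![a, b, 1] i))) : ℤ) : ℚ) * ampl (Fintype.card 𝓀[K]) k B / 4 := by
  intro K _ _ _ _ σ ϖ d t hD h2 δ hδ hδ0 a b ha hb _ _ n₁ n₂ n₃ hE T hT k hk i B hB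
  obtain ⟨-, hvσ, -, -, -, hd1, -⟩ := id hD
  have hN₀ : d ≤ depthOfRecord d := by unfold depthOfRecord; split_ifs <;> omega
  obtain ⟨-, -, -, -, -, h₁, h₂, h₃, -, -, -⟩ := id hE
  -- (1) the three glue witnesses (foot 0 ∕ H corner, the swapped foot, the rescaled foot)
  obtain ⟨f₀, hσf₀, hf₀⟩ := exists_glue_witness hD hE hN₀
  obtain ⟨f₁, hσf₁, hf₁⟩ := exists_glue_witness hD (isElementDatum_swap hE) hN₀
  obtain ⟨f₂, hσf₂, hf₂⟩ := exists_glue_witness hD (isElementDatum_rescale hvσ hE) hN₀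
  -- (2) the trunk: the sum IS the witness token times the amplitude
  rw [finsum_kappaCount_typeZero_eq_token_mul_ampl hD h2 hE T hT k hk i B hB hσf₀ hσf₁ hσf₂ hf₀ hf₁ hf₂]
  by_cases hB1 : 1 ≤ B
  · -- (4) ALIVE axis: the witness token is the law token
    have hshift : shiftR d t = ((d - d % 2 : ℕ) : ℤ) := rfl
    rw [hshift] at hB
    have hiso := isoceles_of_isElementDatum hD hE
    have htok :
        (if n₁ = n₂ ∧ n₂ = n₃ then ((((![normSign σ (-(1 + f₀)), normSign σ f₀ * normSign σ (-(1 + f₀)), normSign σ f₀] : Fin 3 → ℤ) i : ℤ) : ℚ))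
        else if n₂ = n₃ then (![![(normSign σ (-1 : K) : ℚ) * normSign σ (1 + f₀), (normSign σ (-1 : K) : ℚ) * normSign σ f₀ * normSign σ (1 + f₀), (normSign σ f₀ : ℚ)],
           ![(normSign σ (-1 : K) : ℚ) * normSign σ f₁ * normSign σ (1 + f₁), (normSign σ (-1 : K) : ℚ) * normSign σ (1 + f₁), (normSign σ f₁ : ℚ)],
           ![(normSign σ f₂ : ℚ), (normSign σ (-1 : K) : ℚ) * normSign σ f₂ * normSign σ (1 + f₂), (normSign σ (-1 : K) : ℚ) * normSign σ (1 + f₂)]] : Fin 3 → Fin 3 → ℚ) 0 i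
        else if n₁ = n₃ then (![![(normSign σ (-1 : K) : ℚ) * normSign σ (1 + f₀), (normSign σ (-1 : K) : ℚ) * normSign σ f₀ * normSign σ (1 + f₀), (normSign σ f₀ : ℚ)],
           ![(normSign σ (-1 : K) : ℚ) * normSign σ f₁ * normSign σ (1 + f₁), (normSign σ (-1 : K) : ℚ) * normSign σ (1 + f₁), (normSign σ f₁ : ℚ)],
           ![(normSign σ f₂ : ℚ), (normSign σ (-1 : K) : ℚ) * normSign σ f₂ * normSign σ (1 + f₂), (normSign σ (-1 : K) : ℚ) * normSign σ (1 + f₂)]] : Fin 3 → Fin 3 → ℚ) 1 i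
        else (![![(normSign σ (-1 : K) : ℚ) * normSign σ (1 + f₀), (normSign σ (-1 : K) : ℚ) * normSign σ f₀ * normSign σ (1 + f₀), (normSign σ f₀ : ℚ)],
           ![(normSign σ (-1 : K) : ℚ) * normSign σ f₁ * normSign σ (1 + f₁), (normSign σ (-1 : K) : ℚ) * normSign σ (1 + f₁), (normSign σ f₁ : ℚ)],
           ![(normSign σ f₂ : ℚ), (normSign σ (-1 : K) : ℚ) * normSign σ f₂ * normSign σ (1 + f₂), (normSign σ (-1 : K) : ℚ) * normSign σ (1 + f₂)]] : Fin 3 → Fin 3 → ℚ) 2 i) =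
          ((omegaR K σ ϖ d a b i * ((![normSign σ (-1 : K), normSign σ (-1 : K), 1] : Fin 3 → ℤ) i *
            (baseSign σ i * normSign σ (fPartProd δ ![a, b, 1] i))) : ℤ) : ℚ) := by
      by_cases h123 : n₁ = n₂ ∧ n₂ = n₃
      · -- the H corner: all three depths equal `n₁`
        rw [if_pos h123]
        obtain ⟨h12, h23⟩ := h123
        have h₂' : Valued.v (a * a - 1) = Valued.v ϖ ^ n₁ := by rw [h12]; exact h₂
        have h₃' : Valued.v (a * a - b * b) = Valued.v ϖ ^ n₁ := by rw [h12, h23]; exact h₃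
        have hni : (((![n₁, n₂, n₃] : Fin 3 → ℕ) i : ℕ) : ℤ) = n₁ := by fin_cases i <;> simp [h12, h23]
        rw [hni] at hB
        exact hCorner_slot hD hδ hδ0 ha hb h₁ h₂' h₃' hσf₀ (hf₀ h23 (by omega)) (by omega) i
      · rw [if_neg h123]
        by_cases h23 : n₂ = n₃
        · -- foot 0: `n₂ = n₃ < n₁`
          rw [if_pos h23]
          have h21 : n₂ ≤ n₁ := by omega
          fin_cases i
          · simp only [Fin.zero_eta, Fin.isValue, Matrix.cons_val_zero] at hB ⊢
            exact footZero_slot_zero hD hδ hδ0 ha hb h₁ h₂ h₃ h23 hσf₀ (hf₀ h23 h21) (by omega)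
          · simp only [Fin.mk_one, Fin.isValue, Matrix.cons_val_one, Matrix.cons_val_zero] at hB ⊢
            exact footZero_slot_one hD hδ hδ0 ha hb h₁ h₂ h₃ h23 h21 hσf₀ (hf₀ h23 h21) (by omega)
          · simp only [Fin.reduceFinMk, Fin.isValue, Matrix.cons_val_two, Matrix.cons_val_zero, Matrix.tail_cons, Matrix.head_cons] at hB ⊢
            exact footZero_slot_two hD hδ hδ0 ha hb h₁ h₂ h₃ h21 hσf₀ (hf₀ h23 h21) (by omega)
        · rw [if_neg h23]
          by_cases h13 : n₁ = n₃
          · -- foot 1: `n₁ = n₃ < n₂`, the swapped datum `(b, a)`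
            rw [if_pos h13]
            have h12 : n₁ ≤ n₂ := by omega
            fin_cases i
            · simp only [Fin.zero_eta, Fin.isValue, Matrix.cons_val_zero, Matrix.cons_val_one] at hB ⊢
              exact footOne_slot_zero hD hδ hδ0 ha hb h₁ h₂ h₃ h13 h12 hσf₁ (hf₁ h13 h12) (by omega)
            · simp only [Fin.mk_one, Fin.isValue, Matrix.cons_val_one, Matrix.cons_val_zero] at hB ⊢
              exact footOne_slot_one hD hδ hδ0 ha hb h₁ h₂ h₃ h13 hσf₁ (hf₁ h13 h12) (by omega)
            · simp only [Fin.reduceFinMk, Fin.isValue, Matrix.cons_val_two, Matrix.cons_val_one, Matrix.cons_val_zero, Matrix.tail_cons, Matrix.head_cons] at hB ⊢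
              exact footOne_slot_two hD hδ hδ0 ha hb h₁ h₂ h₃ h12 hσf₁ (hf₁ h13 h12) (by omega)
          · -- foot 2: `n₁ = n₂ < n₃`, the rescaled datum `(a⁻¹, b·a⁻¹)`
            rw [if_neg h13]
            have h12 : n₁ = n₂ := by omega
            have h23' : n₂ ≤ n₃ := by omega
            fin_cases i
            · simp only [Fin.zero_eta, Fin.isValue, Matrix.cons_val_zero, Matrix.cons_val_two, Matrix.tail_cons, Matrix.head_cons] at hB ⊢
              exact footTwo_slot_zero hD hδ hδ0 ha hb h₁ h₂ h₃ h23' hσf₂ (hf₂ h12.symm h23') (by omega)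
            · simp only [Fin.mk_one, Fin.isValue, Matrix.cons_val_one, Matrix.cons_val_two, Matrix.cons_val_zero, Matrix.tail_cons, Matrix.head_cons] at hB ⊢
              exact footTwo_slot_one hD hδ hδ0 ha hb h₁ h₂ h₃ h12 h23' hσf₂ (hf₂ h12.symm h23') (by omega)
            · simp only [Fin.reduceFinMk, Fin.isValue, Matrix.cons_val_two, Matrix.tail_cons, Matrix.head_cons] at hB ⊢
              exact footTwo_slot_two hD hδ hδ0 ha hb h₁ h₂ h₃ h12 hσf₂ (hf₂ h12.symm h23') (by omega)
    rw [htok, mul_div_assoc]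
  · -- (3) DEAD axis: the amplitude vanishes on both sides
    have hB0 : B ≤ 0 := by omega
    rw [ampl_eq_zero_of_nonpos (Fintype.card_pos_iff.2 ⟨0⟩) k hB0, zero_div, mul_zero, mul_zero, zero_div]

end Summit.HodgeConjecture.HodgeConjecture.Cruxes.H413.F0P3cDyRamKappaSignCount2TypeZero

end
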